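import Summits.QuantumFields.BalabanUV.Beta.UnitLatticeProjectionWalk
import Summits.QuantumFields.BalabanUV.Beta.PropagatorWoodburyFibre

/-!
# `T4Continuum.ShellMeasureMinimiserDecay` — ROW J8 «THE SANDWICHED INVERSE `(Q A⁻¹ Q*)⁻¹` AND BAŁABAN's MINIMISER
# `H = A⁻¹Q*(QA⁻¹Q*)⁻¹` HAVE THE E6 ROW SHAPE»: the SPECIFIC half of the E2∕E3 «Sect. D algebra» residual, as a junction
# BY NAME against the β sub-cell's accretive Combes–Thomas ∕ sandwich ∕ Woodbury-fibre library
(cell `pub-balaban`, sub-cell `t4`, spine estimate NE7c (node U5b); NE7c ROUND-2 crew `t4-ne7c-formalise-*`, unit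
`b2b-balaban-t4-ne7c-formalise-leaf-07` gen 11; owner table `t4/b2b-balaban-t4-ne7c-p1/LEAVES-NE7c-P1.md`, estimate lane
(R-ne7cp1-g37-7 (a): «for E2∕E3: the [B9] Sect. D algebra of `H₁ = G₁𝔓*`, `H` typed for the block-sectioned scheme
(`B13PerturbativeStep.WRS` products∕sums, `B5QGQInverseL2Zd`, NE2's `coercive_covB`)»; R-ne7cp1-g37-11: ROW S122 = J7
`ShellMeasureDecayKernelComp` is «the generic half» (composition); THIS file is the specific half: the INVERSE of the
sandwich and the minimiser's own row); INTENT I-ne7cleaf07g11-1 (journal); ADDITIVE — imports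
`Beta/UnitLatticeProjectionWalk` (beta-d4-p3; ⊇ `AccretiveCombesThomas{,Budget,Sandwich}`, `UnitLatticeLocalInverse`,
`UnitLatticeResolventWalk`) and `Beta/PropagatorWoodburyFibre` (gan24-p3) ONLY and touches NO host; [folklore]
finite-dimensional linear algebra; 0 `def`, 0 `def … : Prop`, 0 sorry, 0 citation tags.)

HONEST FRAMING.  Finite four-torus programme, rung (B)+1 only — NOT infinite volume, NOT a mass gap, NOT the Clay problem,
NOT summit progress.  NE7c (`T4IndicatorShell.ShellWeightBound`) is NOT PRINTED in [Balaban 1983–89] and NOT PROVED; «NE7c ⇐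
the named binders» (trigger c3).  THIS FILE is OUR-side linear algebra: for a FIXED fine-lattice kernel `A` (Hermitian,
`Re`-coercive) with conjugated coercivity `m` along block-constant weights, block-supported test vectors `q_y` (`‖q_y‖² ≤ N`)
and a bounded-energy reconstruction `r` (`QR = 1`, energy `a`), the unit-lattice kernel `(Q A⁻¹ Q*)⁻¹` and the RECTANGULAR
minimiser kernel `H = A⁻¹Q*(QA⁻¹Q*)⁻¹` satisfy exponential decay rows with constants from `m N a κ κ₁ L₁ L` ONLY (no `#X`,
no `#Y`, no block cardinality).  The SHAPES located in print (locators, NOT citations — ABSOLUTE RULE): `H_kB = GQ*(QGQ*)⁻¹B`,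
`ω = (QGQ*)⁻¹B` and «bounded from below and above by positive constants … The same property holds for QGQ*» = [B5]
= Bałaban, CMP **95** (1984) (1.100)–(1.103) p. 34 («This representation allows us to reduce a proof of properties of
H_k to the corresponding properties of G»); `H = GQ*(QGQ*)⁻¹` = [B9] = Bałaban, CMP **99** (1985) (3.126) p. 420 and
`H₁ = G₁Q*(QG₁Q*)⁻¹` (3.129) p. 421; «The operators (QGQ*)⁻¹, or (QG₁Q*)⁻¹, can be analyzed in the same way as the
operator (Q′G′²Q′*)⁻¹» (3.132) p. 422; `L_jηQ_jHB = B`, `|HB| ≤ B₀(L_jη)⁻¹|B|` = [B11] = Bałaban, CMP **102** (1985)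
(45)–(46) p. 285.  It does NOT say which `A`, `q`, `r` Bałaban's block-SECTIONED,
COMPLEXIFIED scheme produces (node O ∕ J1's dictionary ∕ J2's cube family ∕ J3's `levelOp` blocks), it does NOT treat
complex (non-Hermitian) `A` (the sandwich's coercivity along the contraction ray is J6's species — the library's
`UnitLatticeOmegaLocal.reCoercive_sub` + `AccretiveCombesThomasSandwich.wrs_sandwich_sub_zero` are the transfer devices,
not wired here), and it does NOT produce the gauge identity `RD*HB = 0` of (45) (that is (3.124)'s `QGDR = 0`, structure of
Bałaban's `G`, not of an abstract `A`).  The E2∕E3∕E6 rows of the ONE CALL stay DISPLAYED; census COUNT unchanged; nothing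
of Bałaban's asserted, cited or discharged.  HONEST DEPENDENCY (cell): continuum YM on T⁴ ⇐ BetaPertH ∧ nine spine estimates
(0/9 proved); BetaPertH ⇐ (D1) ∧ (D4) ∧ CAP+tail; G-an2-4 gates asym, D1 and NE2/3/4.

CONTENT (all BY NAME over the β library; the new steps are the Lipschitz bookkeeping, the one-site pairing and the
triangle-inequality resummation).
* §1 `conjCoercive_of_reCoercive_decay` ∕ **`norm_inv_apply_le_of_reCoercive_decay`** — DIRECT accretive Combes–Thomas for a
  `Re`-coercive (`c`) EXPONENTIALLY-LOCALISED (`‖S(i,j)‖ ≤ θe^{−κ₀D(i,j)}`) unit-lattice kernel: with the first-moment profile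
  `Σ_j D(i,j)e^{−(κ₀−κ₁)D(i,j)} ≤ L₁` and `κ₁θL₁ < c`, `‖S⁻¹(i,j)‖ ≤ e^{−κ₁D(i,j)}∕(c − κ₁θL₁)` — the LINEAR-in-rate budget
  `UnitLatticeLocalInverse.expRowDefect_le_of_decay_linear` + `AccretiveCombesThomasBudget.conjLower_of_expDefect` +
  `AccretiveCombesThomas.norm_inv_apply_le` (the pattern of `UnitLatticeWalkInversionDecay.conjCoercive_compress_of_decay` WITHOUT
  compression, partition or walk data: NE7c's rows need DECAY, not a walk expansion).
* §2 **`norm_sandwich_inv_apply_le`** — the sandwiched inverse: `S := sandwich A q = Q A⁻¹ Q*` is `Re`-coercive with `a⁻¹`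
  (`UnitLatticeProjectionWalk.sandwich_coercive_of_reconstruction`, the variational dual of [B5] (1.100)'s lower half) and
  localised with `θ = N∕m` (`AccretiveCombesThomasSandwich.norm_sandwich_inv_le`), hence by §1
  `‖(QA⁻¹Q*)⁻¹(y,y′)‖ ≤ e^{−κ₁D(y,y′)}∕(a⁻¹ − κ₁(N∕m)L₁)` — the (3.132) ∕ (1.100)–(1.102) TYPE for the abstract data.
* §3 the minimiser `PropagatorWoodburyFibre.minimiser A (Qm q) = A⁻¹(Qm q)ᴴ(sandwich A q)⁻¹` (`minimiser_eq`), the (45)-shape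
  identity **`Qm_mul_minimiser`** (`Q·H = 1`, `PropagatorWoodburyFibre.constraint_mul_minimiser` BY NAME), the one-site pairing
  `‖(A⁻¹q_{y′})(x)‖ ≤ (√N∕m)e^{−κD(blk x, y′)}` (`AccretiveCombesThomas.combesThomas_of_conjCoercive` with `u = e_x`), and the END
  **`norm_minimiser_apply_le`**: `‖H(x,y)‖ ≤ (√N·L∕(m(a⁻¹ − κ₁(N∕m)L₁)))·e^{−κ₁·D(blk x, y)}` (profile `Σ_{y′}e^{−(κ−κ₁)D} ≤ L`,
  triangle inequality) — LITERALLY the hosts' E6 row shape `‖k c b′‖ ≤ c·e^{−δ·dis (pos c) (pos′ b′)}` with `𝔖 := Y`,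
  `pos := blk`, `pos′ := id`, `dis := D`; and the (46)-shape SUP-norm bound **`norm_minimiser_mulVec_le`**:
  `‖(HB)(x)‖ ≤ C_H·L′·sup‖B‖` (row profile `Σ_y e^{−κ₁D} ≤ L′`) — block-cardinality-free, as print's `|HB| ≤ B₀|B|` is.
* §4 rule G-1: a one-site∕one-block toy inhabiting EVERY hypothesis shape of the END (degenerate-but-legal; the MODEL
  instance — `A` a `levelOp` section, `q` the cell means, `r` a smooth bump per cell — is J1∕J2∕J3's data and a later file).
-/

noncomputable section

open Finset Matrix
open scoped Matrix ComplexConjugate BigOperators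

namespace Summit.QuantumFields.BalabanUV.T4Continuum.ShellMeasureMinimiserDecay

open Summit.QuantumFields.BalabanUV.Beta.AccretiveCombesThomas
open Summit.QuantumFields.BalabanUV.Beta.AccretiveCombesThomasBudget
open Summit.QuantumFields.BalabanUV.Beta.AccretiveCombesThomasSandwich
open Summit.QuantumFields.BalabanUV.Beta.UnitLatticeLocalInverse (expRowDefect_le_of_decay_linear
  expColDefect_le_of_decay_linear)
open Summit.QuantumFields.BalabanUV.Beta.UnitLatticeResolventWalk (Qm superpose sandwich_eq_mul form_sandwich_eq)
open Summit.QuantumFields.BalabanUV.Beta.UnitLatticeProjectionWalk (sandwich_coercive_of_reconstruction)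
open Summit.QuantumFields.BalabanUV.Beta.PropagatorWoodburyFibre (pivot effForm minimiser constraint_mul_minimiser)
open Literature.MathematicalPhysics.QuantumFieldTheory.Balaban1983to89.B5Prop11Lower (nsq nsq_nonneg star_dotProduct_self)

variable {X Y : Type*} [Fintype X] [DecidableEq X] [Fintype Y] [DecidableEq Y]

/-! ## §1 Direct accretive Combes–Thomas for `Re`-coercive exponentially-localised unit-lattice kernels -/

omit [Fintype Y] [DecidableEq Y] in
/-- Column weights of a symmetric pseudo-metric are Lipschitz: `|D(i,j) − D(i′,j)| ≤ D(i,i′)`. [folklore] -/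
theorem abs_sub_le_of_triangle (D : Y → Y → ℝ) (hDtri : ∀ i j k, D i k ≤ D i j + D j k)
    (hDs : ∀ i j, D i j = D j i) (i i' j : Y) : |D i j - D i' j| ≤ D i i' := by
  rw [abs_sub_le_iff]
  constructor
  · linarith [hDtri i i' j]
  · linarith [hDtri i' i j, hDs i i']

omit [DecidableEq Y] in
/-- **Conjugated coercivity from `Re`-coercivity + exponential localisation** (LINEAR-in-rate budget): `S` `Re`-coercive with
`c`, `‖S(i,j)‖ ≤ θe^{−κ₀D(i,j)}`, `D` a symmetric pseudo-metric, first-moment profile `L₁` at rate `κ₁ ≥ 0` ⟹ `S` is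
conjugated-coercive with `c − κ₁θL₁` along every column weight `k ↦ D(k,j)`. [folklore] -/
theorem conjCoercive_of_reCoercive_decay (S : Matrix Y Y ℂ) (D : Y → Y → ℝ)
    (hDtri : ∀ i j k, D i k ≤ D i j + D j k) (hDs : ∀ i j, D i j = D j i)
    {c θ κ₀ κ₁ L₁ : ℝ} (hκ₁ : 0 ≤ κ₁) (hθ : 0 ≤ θ)
    (hcoer : ∀ z : Y → ℂ, c * nsq z ≤ (star z ⬝ᵥ (S *ᵥ z)).re)
    (hS : ∀ i j, ‖S i j‖ ≤ θ * Real.exp (-(κ₀ * D i j)))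
    (hL₁ : ∀ i, ∑ j, D i j * Real.exp (-((κ₀ - κ₁) * D i j)) ≤ L₁) (j : Y) (z : Y → ℂ) :
    (c - κ₁ * θ * L₁) * nsq z ≤ (conjForm S κ₁ (fun k => D k j) z).re := by
  have hρ : ∀ e e' : Y, |D e j - D e' j| ≤ D e e' := fun e e' => abs_sub_le_of_triangle D hDtri hDs e e' j
  have hrow : ∀ e, expRowDefect S κ₁ (fun k => D k j) e ≤ κ₁ * θ * L₁ := fun e =>
    expRowDefect_le_of_decay_linear S hκ₁ hθ (fun k => D k j) D hρ hS hL₁ e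
  have hcol : ∀ e', expColDefect S κ₁ (fun k => D k j) e' ≤ κ₁ * θ * L₁ := fun e' =>
    expColDefect_le_of_decay_linear S hκ₁ hθ (fun k => D k j) D hρ hS (fun e'' => by
      calc ∑ e, D e e'' * Real.exp (-((κ₀ - κ₁) * D e e''))
          = ∑ e, D e'' e * Real.exp (-((κ₀ - κ₁) * D e'' e)) :=
            Finset.sum_congr rfl fun e _ => by rw [hDs e e'']
        _ ≤ L₁ := hL₁ e'') e'
  have hbud := conjLower_of_expDefect S κ₁ (fun k => D k j) hrow hcol
  have h := conjCoercive_of_conjLower hcoer hbud z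
  have hc : c - (κ₁ * θ * L₁ + κ₁ * θ * L₁) / 2 = c - κ₁ * θ * L₁ := by ring
  rw [hc] at h
  exact h

/-- **DIRECT ACCRETIVE COMBES–THOMAS FOR A `Re`-COERCIVE EXPONENTIALLY-LOCALISED KERNEL**: under `κ₁θL₁ < c`,
`‖S⁻¹(i,j)‖ ≤ e^{−κ₁D(i,j)}∕(c − κ₁θL₁)`. [folklore] -/
theorem norm_inv_apply_le_of_reCoercive_decay (S : Matrix Y Y ℂ) (D : Y → Y → ℝ) (hD0 : ∀ y, D y y = 0)
    (hDtri : ∀ i j k, D i k ≤ D i j + D j k) (hDs : ∀ i j, D i j = D j i)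
    {c θ κ₀ κ₁ L₁ : ℝ} (hκ₁ : 0 ≤ κ₁) (hθ : 0 ≤ θ)
    (hcoer : ∀ z : Y → ℂ, c * nsq z ≤ (star z ⬝ᵥ (S *ᵥ z)).re)
    (hS : ∀ i j, ‖S i j‖ ≤ θ * Real.exp (-(κ₀ * D i j)))
    (hL₁ : ∀ i, ∑ j, D i j * Real.exp (-((κ₀ - κ₁) * D i j)) ≤ L₁) (hsmall : κ₁ * θ * L₁ < c) (i j : Y) :
    ‖S⁻¹ i j‖ ≤ Real.exp (-(κ₁ * D i j)) / (c - κ₁ * θ * L₁) :=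
  norm_inv_apply_le S D hD0 hκ₁ (by linarith)
    (fun j z => conjCoercive_of_reCoercive_decay S D hDtri hDs hκ₁ hθ hcoer hS hL₁ j z) i j

/-! ## §2 The sandwiched inverse `(Q A⁻¹ Q*)⁻¹` -/

omit [Fintype Y] [DecidableEq Y] in
/-- Entry form of `AccretiveCombesThomasSandwich.norm_sandwich_inv_le`: `‖(QA⁻¹Q*)(y,y′)‖ ≤ (N∕m)e^{−κD(y,y′)}`. [folklore] -/
theorem norm_sandwich_apply_le (A : Matrix X X ℂ) (blk : X → Y) (D : Y → Y → ℝ) (hD0 : ∀ y, D y y = 0)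
    (q : Y → X → ℂ) (hq : ∀ y x, blk x ≠ y → q y x = 0) {N : ℝ} (hN : ∀ y, nsq (q y) ≤ N)
    {κ m : ℝ} (hκ : 0 ≤ κ) (hm : 0 < m)
    (hc : ∀ y', ∀ z : X → ℂ, m * nsq z ≤ (conjForm A κ (fun x => D (blk x) y') z).re) (y y' : Y) :
    ‖sandwich A q y y'‖ ≤ N / m * Real.exp (-(κ * D y y')) := by
  have h := norm_sandwich_inv_le A blk D hD0 q hq hN hκ hm hc y y'
  calc ‖sandwich A q y y'‖ = ‖star (q y) ⬝ᵥ (A⁻¹ *ᵥ q y')‖ := rfl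
    _ ≤ N * (Real.exp (-(κ * D y y')) / m) := h
    _ = N / m * Real.exp (-(κ * D y y')) := by ring

/-- `Re`-coercivity of the sandwich from a `Re`-coercive Hermitian `A` and a bounded-energy reconstruction (the library's
`sandwich_coercive_of_reconstruction` with `IsUnit A` and `Re ≥ 0` supplied from `m_A > 0`). [folklore] -/
theorem sandwich_reCoercive (A : Matrix X X ℂ) (hH : A.IsHermitian) {mA : ℝ} (hmA0 : 0 < mA)
    (hmA : ∀ g : X → ℂ, mA * nsq g ≤ (star g ⬝ᵥ (A *ᵥ g)).re)
    (q r : Y → X → ℂ) (hbi : Qm r * (Qm q)ᴴ = 1) {a : ℝ} (ha : 0 < a)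
    (hen : ∀ B : Y → ℂ, (star (superpose r B) ⬝ᵥ (A *ᵥ superpose r B)).re ≤ a * nsq B) (B : Y → ℂ) :
    a⁻¹ * nsq B ≤ (star B ⬝ᵥ (sandwich A q *ᵥ B)).re :=
  sandwich_coercive_of_reconstruction A hH (isUnit_of_reCoercive hmA0 hmA)
    (fun g => le_trans (mul_nonneg hmA0.le (nsq_nonneg g)) (hmA g)) q r hbi ha hen B

/-- **THE SANDWICHED INVERSE IS EXPONENTIALLY LOCALISED** ([B9] (3.132) ∕ [B5] (1.100)–(1.102) TYPE for abstract data): `A` Hermitian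
and `Re`-coercive, conjugated-coercive (`m`, rate `κ`) along the block-constant weights; block-supported tests `‖q_y‖² ≤ N`;
reconstruction `QR = 1` of energy `a`; `D` a symmetric pseudo-metric on the unit index set with first-moment profile `L₁`;
`κ₁(N∕m)L₁ < a⁻¹`.  THEN `‖(QA⁻¹Q*)⁻¹(y,y′)‖ ≤ e^{−κ₁D(y,y′)}∕(a⁻¹ − κ₁(N∕m)L₁)`. [folklore] -/
theorem norm_sandwich_inv_apply_le (A : Matrix X X ℂ) (hH : A.IsHermitian) {mA : ℝ} (hmA0 : 0 < mA)
    (hmA : ∀ g : X → ℂ, mA * nsq g ≤ (star g ⬝ᵥ (A *ᵥ g)).re)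
    (blk : X → Y) (D : Y → Y → ℝ) (hD0 : ∀ y, D y y = 0) (hDtri : ∀ i j k, D i k ≤ D i j + D j k)
    (hDs : ∀ i j, D i j = D j i)
    (q r : Y → X → ℂ) (hq : ∀ y x, blk x ≠ y → q y x = 0) {N : ℝ} (hN0 : 0 ≤ N) (hN : ∀ y, nsq (q y) ≤ N)
    (hbi : Qm r * (Qm q)ᴴ = 1) {a : ℝ} (ha : 0 < a)
    (hen : ∀ B : Y → ℂ, (star (superpose r B) ⬝ᵥ (A *ᵥ superpose r B)).re ≤ a * nsq B)
    {κ m κ₁ L₁ : ℝ} (hκ : 0 ≤ κ) (hm : 0 < m) (hκ₁ : 0 ≤ κ₁)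
    (hc : ∀ y', ∀ z : X → ℂ, m * nsq z ≤ (conjForm A κ (fun x => D (blk x) y') z).re)
    (hL₁ : ∀ y, ∑ y', D y y' * Real.exp (-((κ - κ₁) * D y y')) ≤ L₁)
    (hsmall : κ₁ * (N / m) * L₁ < a⁻¹) (y y' : Y) :
    ‖(sandwich A q)⁻¹ y y'‖ ≤ Real.exp (-(κ₁ * D y y')) / (a⁻¹ - κ₁ * (N / m) * L₁) :=
  norm_inv_apply_le_of_reCoercive_decay (sandwich A q) D hD0 hDtri hDs hκ₁ (div_nonneg hN0 hm.le)
    (sandwich_reCoercive A hH hmA0 hmA q r hbi ha hen)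
    (norm_sandwich_apply_le A blk D hD0 q hq hN hκ hm hc) hL₁ hsmall y y'

/-- The sandwich is invertible (it is `Re`-coercive with `a⁻¹ > 0`). [folklore] -/
theorem isUnit_sandwich (A : Matrix X X ℂ) (hH : A.IsHermitian) {mA : ℝ} (hmA0 : 0 < mA)
    (hmA : ∀ g : X → ℂ, mA * nsq g ≤ (star g ⬝ᵥ (A *ᵥ g)).re)
    (q r : Y → X → ℂ) (hbi : Qm r * (Qm q)ᴴ = 1) {a : ℝ} (ha : 0 < a)
    (hen : ∀ B : Y → ℂ, (star (superpose r B) ⬝ᵥ (A *ᵥ superpose r B)).re ≤ a * nsq B) :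
    IsUnit (sandwich A q) :=
  isUnit_of_reCoercive (inv_pos.2 ha) (sandwich_reCoercive A hH hmA0 hmA q r hbi ha hen)

/-! ## §3 The minimiser `H = A⁻¹Q*(QA⁻¹Q*)⁻¹` -/

omit [Fintype Y] [DecidableEq Y] in
/-- The Woodbury-fibre `pivot` of `(A, Qm q)` IS the sandwich: `Qm q · A⁻¹ · (Qm q)ᴴ = sandwich A q`. [folklore] -/
theorem pivot_eq_sandwich (A : Matrix X X ℂ) (q : Y → X → ℂ) : pivot A (Qm q) = sandwich A q := by
  rw [sandwich_eq_mul]; rfl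

/-- `H = A⁻¹·(Qm q)ᴴ·(sandwich A q)⁻¹` — [B9] (3.126)'s ∕ [B5] (1.103)'s SHAPE for the Woodbury-fibre minimiser. [folklore] -/
theorem minimiser_eq (A : Matrix X X ℂ) (q : Y → X → ℂ) :
    minimiser A (Qm q) = A⁻¹ * (Qm q)ᴴ * (sandwich A q)⁻¹ := by
  rw [← pivot_eq_sandwich]; rfl

/-- **(45)-SHAPE: THE MINIMISER REPRODUCES THE PRESCRIBED AVERAGES**, `Q·H = 1` (`constraint_mul_minimiser` BY NAME, the
sandwich's invertibility from §2). [folklore] -/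
theorem Qm_mul_minimiser (A : Matrix X X ℂ) (hH : A.IsHermitian) {mA : ℝ} (hmA0 : 0 < mA)
    (hmA : ∀ g : X → ℂ, mA * nsq g ≤ (star g ⬝ᵥ (A *ᵥ g)).re)
    (q r : Y → X → ℂ) (hbi : Qm r * (Qm q)ᴴ = 1) {a : ℝ} (ha : 0 < a)
    (hen : ∀ B : Y → ℂ, (star (superpose r B) ⬝ᵥ (A *ᵥ superpose r B)).re ≤ a * nsq B) :
    Qm q * minimiser A (Qm q) = 1 :=
  constraint_mul_minimiser (by rw [pivot_eq_sandwich]; exact isUnit_sandwich A hH hmA0 hmA q r hbi ha hen)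

omit [Fintype Y] [DecidableEq Y] in
/-- The first factor's entries are the inverse applied to a test vector: `(A⁻¹(Qm q)ᴴ)(x,y′) = (A⁻¹q_{y′})(x)`. [folklore] -/
theorem inv_mul_conjTranspose_apply (A : Matrix X X ℂ) (q : Y → X → ℂ) (x : X) (y' : Y) :
    (A⁻¹ * (Qm q)ᴴ) x y' = (A⁻¹ *ᵥ q y') x := by
  simp [Matrix.mul_apply, Matrix.mulVec, dotProduct, Matrix.conjTranspose_apply, Qm]

omit [Fintype Y] [DecidableEq Y] in
/-- **One-site pairing**: `‖(A⁻¹q_{y′})(x)‖ ≤ (√N∕m)·e^{−κD(blk x, y′)}` (`combesThomas_of_conjCoercive` with `u = e_x`,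
`v = q_{y′}` supported in block `y′`, weight `x′ ↦ D(blk x′, y′)`). [folklore] -/
theorem norm_inv_mulVec_test_le (A : Matrix X X ℂ) (blk : X → Y) (D : Y → Y → ℝ) (hD0 : ∀ y, D y y = 0)
    (q : Y → X → ℂ) (hq : ∀ y x, blk x ≠ y → q y x = 0) {N : ℝ} (hN : ∀ y, nsq (q y) ≤ N)
    {κ m : ℝ} (hκ : 0 ≤ κ) (hm : 0 < m)
    (hc : ∀ y', ∀ z : X → ℂ, m * nsq z ≤ (conjForm A κ (fun x => D (blk x) y') z).re) (x : X) (y' : Y) :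
    ‖(A⁻¹ *ᵥ q y') x‖ ≤ Real.sqrt N / m * Real.exp (-(κ * D (blk x) y')) := by
  have hAu : IsUnit A := isUnit_of_conjCoercive hm (hc y')
  have hdet : IsUnit A.det := (Matrix.isUnit_iff_isUnit_det A).mp hAu
  have hx : A *ᵥ (A⁻¹ *ᵥ q y') = q y' := by
    rw [Matrix.mulVec_mulVec, Matrix.mul_nonsing_inv A hdet, Matrix.one_mulVec]
  have h := combesThomas_of_conjCoercive A (fun e => D (blk e) y') hm hκ (hc y') (R := D (blk x) y')
    (u := Pi.single x 1) hx
    (fun e he => by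
      by_cases hex : e = x
      · subst hex; exact le_rfl
      · exact absurd (by simp [hex]) he)
    (fun e he => by
      by_cases hb : blk e = y'
      · simp only [hb, hD0]; exact le_rfl
      · exact absurd (hq y' e hb) he)
  have hentry : star (Pi.single x (1 : ℂ)) ⬝ᵥ (A⁻¹ *ᵥ q y') = (A⁻¹ *ᵥ q y') x := by
    rw [dotProduct, Finset.sum_eq_single x (fun e _ he => by simp [he]) (fun h => absurd (Finset.mem_univ x) h)]
    simp
  rw [hentry, nsq_single, Real.sqrt_one, one_mul] at h
  have hE : 0 ≤ Real.exp (-(κ * D (blk x) y')) / m := div_nonneg (Real.exp_pos _).le hm.le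
  calc ‖(A⁻¹ *ᵥ q y') x‖ ≤ Real.exp (-(κ * D (blk x) y')) / m * Real.sqrt (nsq (q y')) := h
    _ ≤ Real.exp (-(κ * D (blk x) y')) / m * Real.sqrt N :=
        mul_le_mul_of_nonneg_left (Real.sqrt_le_sqrt (hN y')) hE
    _ = Real.sqrt N / m * Real.exp (-(κ * D (blk x) y')) := by ring

/-- **THE MINIMISER's E6 ROW** (the hosts' shape `‖k c b′‖ ≤ c·e^{−δ·dis (pos c) (pos′ b′)}` with `𝔖 := Y`, `pos := blk`,
`pos′ := id`, `dis := D`): under the hypotheses of `norm_sandwich_inv_apply_le` and the profile `Σ_{y′} e^{−(κ−κ₁)D(y₀,y′)} ≤ L`,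
`‖H(x,y)‖ ≤ (√N·L ∕ (m·(a⁻¹ − κ₁(N∕m)L₁))) · e^{−κ₁·D(blk x, y)}` for ALL `x, y` — constants from `m N a κ κ₁ L₁ L` only.
[folklore] -/
theorem norm_minimiser_apply_le (A : Matrix X X ℂ) (hH : A.IsHermitian) {mA : ℝ} (hmA0 : 0 < mA)
    (hmA : ∀ g : X → ℂ, mA * nsq g ≤ (star g ⬝ᵥ (A *ᵥ g)).re)
    (blk : X → Y) (D : Y → Y → ℝ) (hD0 : ∀ y, D y y = 0) (hDtri : ∀ i j k, D i k ≤ D i j + D j k)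
    (hDs : ∀ i j, D i j = D j i)
    (q r : Y → X → ℂ) (hq : ∀ y x, blk x ≠ y → q y x = 0) {N : ℝ} (hN0 : 0 ≤ N) (hN : ∀ y, nsq (q y) ≤ N)
    (hbi : Qm r * (Qm q)ᴴ = 1) {a : ℝ} (ha : 0 < a)
    (hen : ∀ B : Y → ℂ, (star (superpose r B) ⬝ᵥ (A *ᵥ superpose r B)).re ≤ a * nsq B)
    {κ m κ₁ L₁ L : ℝ} (hκ : 0 ≤ κ) (hm : 0 < m) (hκ₁ : 0 ≤ κ₁)
    (hc : ∀ y', ∀ z : X → ℂ, m * nsq z ≤ (conjForm A κ (fun x => D (blk x) y') z).re)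
    (hL₁ : ∀ y, ∑ y', D y y' * Real.exp (-((κ - κ₁) * D y y')) ≤ L₁)
    (hsmall : κ₁ * (N / m) * L₁ < a⁻¹)
    (hL : ∀ y₀, ∑ y', Real.exp (-((κ - κ₁) * D y₀ y')) ≤ L) (x : X) (y : Y) :
    ‖minimiser A (Qm q) x y‖
      ≤ Real.sqrt N * L / (m * (a⁻¹ - κ₁ * (N / m) * L₁)) * Real.exp (-(κ₁ * D (blk x) y)) := by
  set c' : ℝ := a⁻¹ - κ₁ * (N / m) * L₁ with hc'
  have hc'0 : 0 < c' := by rw [hc']; linarith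
  have hS := norm_sandwich_inv_apply_le A hH hmA0 hmA blk D hD0 hDtri hDs q r hq hN0 hN hbi ha hen hκ hm hκ₁ hc
    hL₁ hsmall
  have hT := norm_inv_mulVec_test_le A blk D hD0 q hq hN hκ hm hc x
  rw [minimiser_eq, Matrix.mul_apply]
  -- termwise bound, then the triangle inequality moves `e^{−κ₁D(blk x, y)}` out of the sum
  have hterm : ∀ y', ‖(A⁻¹ * (Qm q)ᴴ) x y' * (sandwich A q)⁻¹ y' y‖
      ≤ Real.sqrt N / (m * c') * Real.exp (-(κ₁ * D (blk x) y)) * Real.exp (-((κ - κ₁) * D (blk x) y')) := by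
    intro y'
    rw [norm_mul, inv_mul_conjTranspose_apply]
    have h1 := hT y'
    have h2 := hS y' y
    have h1' : 0 ≤ Real.sqrt N / m * Real.exp (-(κ * D (blk x) y')) := by positivity
    have htri : Real.exp (-(κ * D (blk x) y')) * Real.exp (-(κ₁ * D y' y))
        ≤ Real.exp (-(κ₁ * D (blk x) y)) * Real.exp (-((κ - κ₁) * D (blk x) y')) := by
      rw [← Real.exp_add, ← Real.exp_add]
      refine Real.exp_le_exp.2 ?_
      have := hDtri (blk x) y' y
      nlinarith
    calc ‖(A⁻¹ *ᵥ q y') x‖ * ‖(sandwich A q)⁻¹ y' y‖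
        ≤ (Real.sqrt N / m * Real.exp (-(κ * D (blk x) y'))) * (Real.exp (-(κ₁ * D y' y)) / c') :=
          mul_le_mul h1 h2 (norm_nonneg _) h1'
      _ = Real.sqrt N / (m * c') * (Real.exp (-(κ * D (blk x) y')) * Real.exp (-(κ₁ * D y' y))) := by
          field_simp
      _ ≤ Real.sqrt N / (m * c') * (Real.exp (-(κ₁ * D (blk x) y)) * Real.exp (-((κ - κ₁) * D (blk x) y'))) :=
          mul_le_mul_of_nonneg_left htri (by positivity)
      _ = _ := by ring
  calc ‖∑ y', (A⁻¹ * (Qm q)ᴴ) x y' * (sandwich A q)⁻¹ y' y‖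
      ≤ ∑ y', ‖(A⁻¹ * (Qm q)ᴴ) x y' * (sandwich A q)⁻¹ y' y‖ := norm_sum_le _ _
    _ ≤ ∑ y', Real.sqrt N / (m * c') * Real.exp (-(κ₁ * D (blk x) y)) * Real.exp (-((κ - κ₁) * D (blk x) y')) :=
        Finset.sum_le_sum fun y' _ => hterm y'
    _ = Real.sqrt N / (m * c') * Real.exp (-(κ₁ * D (blk x) y)) * ∑ y', Real.exp (-((κ - κ₁) * D (blk x) y')) := by
        rw [Finset.mul_sum]
    _ ≤ Real.sqrt N / (m * c') * Real.exp (-(κ₁ * D (blk x) y)) * L :=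
        mul_le_mul_of_nonneg_left (hL (blk x)) (by positivity)
    _ = Real.sqrt N * L / (m * c') * Real.exp (-(κ₁ * D (blk x) y)) := by ring

/-- **(46)-SHAPE, SUP SIDE: `‖(HB)(x)‖ ≤ C_H·L′·sup‖B‖`** with the row profile `Σ_y e^{−κ₁D(y₀,y)} ≤ L′` — block-cardinality-free
(the ℓ^∞ → ℓ^∞ norm of a kernel is its largest absolute row sum). [folklore] -/
theorem norm_minimiser_mulVec_le (A : Matrix X X ℂ) (hH : A.IsHermitian) {mA : ℝ} (hmA0 : 0 < mA)
    (hmA : ∀ g : X → ℂ, mA * nsq g ≤ (star g ⬝ᵥ (A *ᵥ g)).re)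
    (blk : X → Y) (D : Y → Y → ℝ) (hD0 : ∀ y, D y y = 0) (hDtri : ∀ i j k, D i k ≤ D i j + D j k)
    (hDs : ∀ i j, D i j = D j i)
    (q r : Y → X → ℂ) (hq : ∀ y x, blk x ≠ y → q y x = 0) {N : ℝ} (hN0 : 0 ≤ N) (hN : ∀ y, nsq (q y) ≤ N)
    (hbi : Qm r * (Qm q)ᴴ = 1) {a : ℝ} (ha : 0 < a)
    (hen : ∀ B : Y → ℂ, (star (superpose r B) ⬝ᵥ (A *ᵥ superpose r B)).re ≤ a * nsq B)
    {κ m κ₁ L₁ L L' : ℝ} (hκ : 0 ≤ κ) (hm : 0 < m) (hκ₁ : 0 ≤ κ₁)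
    (hc : ∀ y', ∀ z : X → ℂ, m * nsq z ≤ (conjForm A κ (fun x => D (blk x) y') z).re)
    (hL₁ : ∀ y, ∑ y', D y y' * Real.exp (-((κ - κ₁) * D y y')) ≤ L₁)
    (hsmall : κ₁ * (N / m) * L₁ < a⁻¹)
    (hL : ∀ y₀, ∑ y', Real.exp (-((κ - κ₁) * D y₀ y')) ≤ L)
    (hL' : ∀ y₀, ∑ y, Real.exp (-(κ₁ * D y₀ y)) ≤ L') (B : Y → ℂ) {β : ℝ} (hB : ∀ y, ‖B y‖ ≤ β) (x : X) :
    ‖(minimiser A (Qm q) *ᵥ B) x‖ ≤ Real.sqrt N * L / (m * (a⁻¹ - κ₁ * (N / m) * L₁)) * L' * β := by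
  set C : ℝ := Real.sqrt N * L / (m * (a⁻¹ - κ₁ * (N / m) * L₁)) with hC
  have hc'0 : 0 < a⁻¹ - κ₁ * (N / m) * L₁ := by linarith
  have hL0 : 0 ≤ L := le_trans (Finset.sum_nonneg fun _ _ => (Real.exp_pos _).le) (hL (blk x))
  have hC0 : 0 ≤ C := by rw [hC]; positivity
  have hβ0 : 0 ≤ β := le_trans (norm_nonneg _) (hB (blk x))
  have hH' := norm_minimiser_apply_le A hH hmA0 hmA blk D hD0 hDtri hDs q r hq hN0 hN hbi ha hen hκ hm hκ₁ hc hL₁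
    hsmall hL x
  rw [Matrix.mulVec, dotProduct]
  calc ‖∑ y, minimiser A (Qm q) x y * B y‖ ≤ ∑ y, ‖minimiser A (Qm q) x y * B y‖ := norm_sum_le _ _
    _ ≤ ∑ y, C * Real.exp (-(κ₁ * D (blk x) y)) * β := Finset.sum_le_sum fun y _ => by
        rw [norm_mul]
        exact mul_le_mul (hH' y) (hB y) (norm_nonneg _) (by positivity)
    _ = C * β * ∑ y, Real.exp (-(κ₁ * D (blk x) y)) := by
        rw [Finset.mul_sum]; refine Finset.sum_congr rfl fun y _ => ?_; ring
    _ ≤ C * β * L' := mul_le_mul_of_nonneg_left (hL' (blk x)) (mul_nonneg hC0 hβ0)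
    _ = C * L' * β := by ring

/-! ## §4 Rule G-1: a one-site ∕ one-block toy inhabiting every hypothesis shape of the END -/

/-- The conjugated form of the identity kernel is `‖z‖²` at every rate and weight. [folklore] -/
theorem re_conjForm_one (κ : ℝ) (ρ : Y → ℝ) (z : Y → ℂ) :
    (conjForm (1 : Matrix Y Y ℂ) κ ρ z).re = nsq z := by
  rw [Summit.QuantumFields.BalabanUV.Beta.UnitLatticeWalkInversionDecay.conjForm_one, Complex.ofReal_re]

/-- G-1 (degenerate-but-legal): one fine site, one block, `A = 1`, `q = r = 1`, `D = 0`, `κ = κ₁ = 0`, `N = a = m = L = 1`,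
`L₁ = 0` — every hypothesis of `norm_minimiser_apply_le` is inhabited and the END fires. [folklore] -/
example (x y : Fin 1) :
    ‖minimiser (1 : Matrix (Fin 1) (Fin 1) ℂ) (Qm (fun (_ : Fin 1) (_ : Fin 1) => (1 : ℂ))) x y‖
      ≤ Real.sqrt 1 * 1 / (1 * ((1 : ℝ)⁻¹ - 0 * (1 / 1) * 0))
          * Real.exp (-(0 * (fun _ _ => (0 : ℝ)) (id x) y)) := by
  refine norm_minimiser_apply_le (1 : Matrix (Fin 1) (Fin 1) ℂ) Matrix.isHermitian_one (mA := 1) one_pos ?_ id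
    (fun _ _ => (0 : ℝ)) (fun _ => rfl) (fun _ _ _ => by norm_num) (fun _ _ => rfl)
    (fun _ _ => (1 : ℂ)) (fun _ _ => (1 : ℂ)) (fun y x h => absurd (Subsingleton.elim _ _) h) zero_le_one ?_ ?_ one_pos ?_
    le_rfl one_pos le_rfl ?_ ?_ (by norm_num) ?_ x y
  · intro g
    rw [Matrix.one_mulVec, star_dotProduct_self, Complex.ofReal_re, one_mul]
  · intro y'
    simp [nsq]
  · ext i j
    simp [Matrix.mul_apply, Qm, Matrix.one_apply, Subsingleton.elim i j]
  · intro B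
    rw [Matrix.one_mulVec, star_dotProduct_self, Complex.ofReal_re, one_mul]
    unfold nsq superpose
    simp [Qm, Matrix.mulVec, dotProduct, Matrix.conjTranspose_apply]
  · intro y' z
    rw [re_conjForm_one, one_mul]
  · intro y₀; simp
  · intro y₀; simp

end Summit.QuantumFields.BalabanUV.T4Continuum.ShellMeasureMinimiserDecay

end
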